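import Literature.RepresentationTheory.Liu2021.GlobalOscillatorIsomorphismCriterion
import HarnessLib

/-!
# Semilinear edition of the Flath uniqueness clause: an injective SEMILINEAR equivariant map between isotypic
# representations forces a semilinear equivariant bijection between their irreducible types

Topic `Literature/RepresentationTheory/Semisimple`; namespace `Literature.RepresentationTheory.Semisimple`.  THEOREMS ONLY
(no definition, no named fact, no `sorry`).

This is the `τ`-SEMILINEAR companion of ✔ `Literature.RepresentationTheory.Liu2021.nonempty_equiv_of_isotypicComponent_eq_top`
(`Liu2021/GlobalOscillatorIsomorphismCriterion.lean`: a `G`-equivariant LINEAR equivalence between a `ρ`-isotypic and a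
`ρ'`-isotypic representation forces `ρ ≃ ρ'` — [FlathCorvallis1979, Thm. 3] uniqueness clause ∕ [Bump1997, §3.4 Prop. 3.4.1 last
bullet]).  For a ring homomorphism `τ : k →+* k'` between the coefficient fields with `RingHomSurjective τ` (e.g. an automorphism
`σ` of `ℂ`), a `τ`-semilinear map `f : W →ₛₗ[τ] W'` with `f (π g w) = π' g (f w)` is the datum «`W^τ → W'` is `G`-linear» of a
GALOIS TWIST; we never form the twisted module, every statement is «`∃ f : V →ₛₗ[τ] V'`, bijective and equivariant», which is the
currency of the consumer ([Liu2021, Thm. 4.18 (3)]: `σ`-semilinear `𝔾(𝔸_F^∞)`-isomorphisms `ω(μ,ε,χ) → ω(μ,ε',χ')`, `σ ∈ Aut(ℂ/M_μ)` —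
tree row III-11 `Thm418Data.EpsRigidUnderGaloisTwist`, typed exactly in this shape).

* §1 (module form, rings `R →+* R'` with `RingHomSurjective`): an injective semilinear map sends atoms of the submodule lattice to
  atoms (`isAtom_map_of_injective`), hence simple submodules to simple submodules (`isSimpleModule_map_of_injective`); so an
  injective `τ̃`-semilinear map from a module `M ≠ 0` which is the sum of its copies of a simple `S` into a module all of whose
  simple submodules are `≃ S'` yields a BIJECTIVE `τ̃`-semilinear `S → S'`
  (`exists_semilinear_bijective_of_isotypicComponent_eq_top`).
* §2 (group algebras): `τ : k →+* k'` induces Mathlib's `MonoidAlgebra.mapRingHom H τ : k[H] →+* k'[H]` (surjective when `τ` is,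
  `mapRingHom_surjective`); a `τ`-semilinear `H`-equivariant `f` is `mapRingHom H τ`-semilinear between the `asModule`s
  (`apply_asAlgebraHom_eq`), and conversely (`exists_semilinear_equivariant_of_mapRingHom_semilinear`).
* §3 (representation form, the consumer's statement): `exists_semilinear_equivariant_bijective_of_isotypicComponent_eq_top` —
  `φ : H →* G`, `f : W →ₛₗ[τ] W'` injective `G`-equivariant, `W ≠ 0`, `π|_H` `ρ`-isotypic and `π'|_H` `ρ'`-isotypic (Mathlib
  `isotypicComponent k[H] … = ⊤`, `ρ`, `ρ'` irreducible) ⟹ `∃ g : V →ₛₗ[τ] V'` bijective with `g (ρ x v) = ρ' x (g v)`.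

Written for the hodgecm-mathlib cell's road to row III-11 (A-provers/A-p19/ROAD-III11-v2.md, piece P2-generic): the restricted tensor
product `ω(μ,ε,χ) = ⊗'_v ω_v` is `ω_v`-isotypic under `U(J_V)(F_v)`, so a `σ`-semilinear global isomorphism yields `σ`-semilinear local
ones.  Nothing here mentions Weil representations; HC_CM is not mentioned further.

## References
* [FlathCorvallis1979] D. Flath, *Decomposition of representations into tensor products*, PSPM 33.1 (1979), Theorem 3 (uniqueness clause).
* [Bump1997] D. Bump, *Automorphic forms and representations*, CUP (1997), §3.4 Prop. 3.4.1 (last bullet).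
* [BourbakiAlgebreVIII2012] N. Bourbaki, *Algèbre VIII*, §4 n°3 (Schur's lemma; semilinear variants are the same argument).
* [Liu2021] Y. Liu, Camb. J. Math. 9 (2021), Thm. 4.18 (3) with proof l. 2272–2289 (the consumer).
-/

noncomputable section

open scoped MonoidAlgebra

namespace Literature.RepresentationTheory.Semisimple

/-! ## §1 Module form -/

section Module

variable {R R' : Type*} [Ring R] [Ring R'] {τ : R →+* R'} [RingHomSurjective τ]
variable {M N : Type*} [AddCommGroup M] [Module R M] [AddCommGroup N] [Module R' N]

/-- **An injective semilinear map sends atoms of the submodule lattice to atoms**: if `m ≤ M` is an atom (a simple submodule)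
and `f : M →ₛₗ[τ] N` is injective (`τ` surjective, so that images are submodules), then `f(m)` is an atom of the submodule
lattice of `N`.  (The submodules of `f(m)` pull back to submodules of `m`.) [cite: BourbakiAlgebreVIII2012, §4 n°3] -/
theorem isAtom_map_of_injective (f : M →ₛₗ[τ] N) (hf : Function.Injective f) {m : Submodule R M} (hm : IsAtom m) :
    IsAtom (m.map f) := by
  refine ⟨fun hbot => ?_, fun p hp => ?_⟩
  · -- `f(m) ≠ ⊥`
    obtain ⟨x, hxm, hx0⟩ := (Submodule.ne_bot_iff m).1 hm.1
    have hfx : f x ∈ m.map f := Submodule.mem_map_of_mem hxm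
    rw [hbot, Submodule.mem_bot] at hfx
    exact hx0 (hf (by rw [hfx, map_zero]))
  · -- a proper submodule `p < f(m)` is `⊥`
    set q : Submodule R M := p.comap f ⊓ m with hq
    by_cases hqm : q = m
    · -- then `m ≤ comap p`, so `map m ≤ p`, contradicting `p < map m`
      exfalso
      have hle : m.map f ≤ p := Submodule.map_le_iff_le_comap.2 (hqm ▸ inf_le_left)
      exact hp.ne (le_antisymm hp.le hle)
    · have hqbot : q = ⊥ := hm.2 q (lt_of_le_of_ne inf_le_right hqm)
      refine (Submodule.eq_bot_iff p).2 fun y hy => ?_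
      obtain ⟨x, hxm, rfl⟩ := (Submodule.mem_map.1 (hp.le hy))
      have hxq : x ∈ q := ⟨hy, hxm⟩
      rw [hqbot, Submodule.mem_bot] at hxq
      rw [hxq, map_zero]

/-- **Simple submodules go to simple submodules** under an injective semilinear map. [cite: BourbakiAlgebreVIII2012, §4 n°3] -/
theorem isSimpleModule_map_of_injective (f : M →ₛₗ[τ] N) (hf : Function.Injective f) (m : Submodule R M)
    [IsSimpleModule R m] : IsSimpleModule R' (m.map f) :=
  isSimpleModule_iff_isAtom.2 (isAtom_map_of_injective f hf (isSimpleModule_iff_isAtom.1 ‹_›))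

/-- The restriction–corestriction `m → f(m)` of an injective semilinear map is a bijective semilinear map (as an existence
statement, to avoid naming the map). [folklore] -/
private theorem exists_semilinear_bijective_submodule_map (f : M →ₛₗ[τ] N) (hf : Function.Injective f) (m : Submodule R M) :
    ∃ fm : m →ₛₗ[τ] m.map f, Function.Bijective fm ∧ ∀ x : m, (fm x : N) = f x := by
  refine ⟨(f.domRestrict m).codRestrict (m.map f) fun x => Submodule.mem_map_of_mem x.2, ⟨?_, ?_⟩, fun x => rfl⟩
  · intro x y hxy
    apply Subtype.ext
    apply hf
    exact congrArg (fun z : m.map f => (z : N)) hxy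
  · rintro ⟨y, hy⟩
    obtain ⟨x, hxm, rfl⟩ := Submodule.mem_map.1 hy
    exact ⟨⟨x, hxm⟩, rfl⟩

/-- **Module form of the semilinear uniqueness clause.**  Let `f : M →ₛₗ[τ] N` be injective (`τ : R →+* R'` surjective), `M ≠ 0`
the sum of its submodules isomorphic to the SIMPLE `R`-module `S` (`isotypicComponent R M S = ⊤`), and `N` such that every simple
`R'`-submodule of `N` is `≃ S'` (`IsIsotypicOfType R' N S'`).  Then there is a BIJECTIVE `τ`-semilinear map `S → S'`: a copy `m ≅ S`
in `M` is simple, its image `f(m)` is simple, hence `≅ S'`, and `S ≅ m → f(m) ≅ S'` composes.  (For `τ = id` this is ✔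
`Liu2021.nonempty_linearEquiv_of_isotypicComponent_eq_top`.)
[cite: FlathCorvallis1979, Theorem 3 (uniqueness clause)] [cite: Bump1997, §3.4 Prop. 3.4.1 (last bullet)] -/
theorem exists_semilinear_bijective_of_isotypicComponent_eq_top {S S' : Type*} [AddCommGroup S] [Module R S]
    [AddCommGroup S'] [Module R' S'] [IsSimpleModule R S] [Nontrivial M] (hM : isotypicComponent R M S = ⊤)
    (hN : IsIsotypicOfType R' N S') (f : M →ₛₗ[τ] N) (hf : Function.Injective f) :
    ∃ g : S →ₛₗ[τ] S', Function.Bijective g := by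
  obtain ⟨m, ⟨e⟩⟩ := Liu2021.exists_submodule_linearEquiv_of_isotypicComponent_eq_top (S := S) hM
  haveI : IsSimpleModule R m := IsSimpleModule.congr e
  haveI : IsSimpleModule R' (m.map f) := isSimpleModule_map_of_injective f hf m
  obtain ⟨e'⟩ := hN (m.map f)
  obtain ⟨fm, hfm, -⟩ := exists_semilinear_bijective_submodule_map f hf m
  refine ⟨(e'.toLinearMap.comp fm).comp e.symm.toLinearMap, ?_⟩
  simp only [LinearMap.coe_comp, LinearEquiv.coe_coe]
  exact (e'.bijective.comp hfm).comp e.symm.bijective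

end Module

/-! ## §2 Group algebras: `τ`-semilinear equivariant maps are `k[H] → k'[H]`-semilinear -/

section GroupAlgebra

variable {k k' : Type*} [Field k] [Field k'] (τ : k →+* k') (H : Type*) [Group H]

/-- `k[H] → k'[H]`, coefficient-wise `τ` (Mathlib `MonoidAlgebra.mapRingHom`), is surjective when `τ` is. [folklore] -/
private theorem mapRingHom_surjective (hτ : Function.Surjective τ) : Function.Surjective (MonoidAlgebra.mapRingHom H τ) := by
  intro y
  induction y using MonoidAlgebra.induction_linear with
  | zero => exact ⟨0, map_zero _⟩
  | add a b ha hb =>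
    obtain ⟨x, rfl⟩ := ha
    obtain ⟨y, rfl⟩ := hb
    exact ⟨x + y, map_add _ _ _⟩
  | single h c =>
    obtain ⟨d, rfl⟩ := hτ c
    exact ⟨MonoidAlgebra.single h d, MonoidAlgebra.mapRingHom_single τ h d⟩

variable {τ H}
variable {W W' : Type*} [AddCommGroup W] [Module k W] [AddCommGroup W'] [Module k' W']

/-- **A `τ`-semilinear `H`-equivariant map intertwines the group-algebra actions along `mapRingHom H τ`**:
`f (a · w) = τ̃(a) · f w` for `a ∈ k[H]` (`k[H]` acting through `asAlgebraHom`). [cite: Bump1997, §3.4 Prop. 3.4.1 (last bullet)] -/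
theorem apply_asAlgebraHom_eq (ρ : Representation k H W) (ρ' : Representation k' H W') (f : W →ₛₗ[τ] W')
    (hf : ∀ (x : H) (w : W), f (ρ x w) = ρ' x (f w)) (a : MonoidAlgebra k H) (w : W) :
    f (ρ.asAlgebraHom a w) = ρ'.asAlgebraHom (MonoidAlgebra.mapRingHom H τ a) (f w) := by
  induction a using MonoidAlgebra.induction_linear with
  | zero => simp only [map_zero, LinearMap.zero_apply]
  | add a b ha hb => simp only [map_add, LinearMap.add_apply, ha, hb]
  | single x c =>
    rw [MonoidAlgebra.mapRingHom_single, Representation.asAlgebraHom_single, Representation.asAlgebraHom_single,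
      LinearMap.smul_apply, LinearMap.smul_apply, LinearMap.map_smulₛₗ, hf]

/-- **Packaging**: a `τ`-semilinear `H`-equivariant `f : W → W'` IS a `mapRingHom H τ`-semilinear map of the `k[H]`- resp.
`k'[H]`-modules `ρ.asModule → ρ'.asModule` with the same underlying function. [cite: Bump1997, §3.4 Prop. 3.4.1 (last bullet)] -/
theorem exists_mapRingHom_semilinear (ρ : Representation k H W) (ρ' : Representation k' H W') (f : W →ₛₗ[τ] W')
    (hf : ∀ (x : H) (w : W), f (ρ x w) = ρ' x (f w)) :
    ∃ F : ρ.asModule →ₛₗ[MonoidAlgebra.mapRingHom H τ] ρ'.asModule,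
      ∀ w : ρ.asModule, ρ'.asModuleEquiv (F w) = f (ρ.asModuleEquiv w) := by
  refine ⟨{ toFun := fun w => ρ'.asModuleEquiv.symm (f (ρ.asModuleEquiv w))
            map_add' := fun x y => by simp only [map_add]
            map_smul' := fun a x => ?_ }, fun w => rfl⟩
  apply ρ'.asModuleEquiv.injective
  rw [LinearEquiv.apply_symm_apply, Representation.asModuleEquiv_map_smul, Representation.asModuleEquiv_map_smul,
    LinearEquiv.apply_symm_apply]
  exact apply_asAlgebraHom_eq ρ ρ' f hf a (ρ.asModuleEquiv x)

/-- `τ̃(algebraMap c) = algebraMap (τ c)` on group algebras. [folklore] -/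
private theorem mapRingHom_algebraMap (c : k) :
    MonoidAlgebra.mapRingHom H τ (algebraMap k (MonoidAlgebra k H) c) = algebraMap k' (MonoidAlgebra k' H) (τ c) := by
  rw [MonoidAlgebra.coe_algebraMap, MonoidAlgebra.coe_algebraMap, Function.comp_apply, Function.comp_apply,
    Algebra.algebraMap_self_apply, Algebra.algebraMap_self_apply, MonoidAlgebra.mapRingHom_single]

/-- `τ̃(of x) = of x` for `x ∈ H`. [folklore] -/
private theorem mapRingHom_of (x : H) :
    MonoidAlgebra.mapRingHom H τ (MonoidAlgebra.of k H x) = MonoidAlgebra.of k' H x := by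
  rw [MonoidAlgebra.of_apply, MonoidAlgebra.of_apply, MonoidAlgebra.mapRingHom_single, map_one]

/-- **Unpackaging**: a `mapRingHom H τ`-semilinear map `ρ.asModule → ρ'.asModule` is a `τ`-semilinear `H`-equivariant map
`V → V'` with the same underlying function (so bijectivity transfers). [cite: Bump1997, §3.4 Prop. 3.4.1 (last bullet)] -/
theorem exists_semilinear_equivariant_of_mapRingHom_semilinear {V V' : Type*} [AddCommGroup V] [Module k V]
    [AddCommGroup V'] [Module k' V'] (ρ : Representation k H V) (ρ' : Representation k' H V')
    (F : ρ.asModule →ₛₗ[MonoidAlgebra.mapRingHom H τ] ρ'.asModule) :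
    ∃ g : V →ₛₗ[τ] V', (∀ v, g v = ρ'.asModuleEquiv (F (ρ.asModuleEquiv.symm v))) ∧
      ∀ (x : H) (v : V), g (ρ x v) = ρ' x (g v) := by
  refine ⟨{ toFun := fun v => ρ'.asModuleEquiv (F (ρ.asModuleEquiv.symm v))
            map_add' := fun x y => by simp only [map_add]
            map_smul' := fun c v => ?_ }, fun v => rfl, fun x v => ?_⟩
  · -- scalars: `c • v ↦ algebraMap c • _` in `asModule`, `τ̃ (algebraMap c) = algebraMap (τ c)`
    simp only [Representation.asModuleEquiv_symm_map_smul, LinearMap.map_smulₛₗ, mapRingHom_algebraMap,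
      Representation.asModuleEquiv_map_smul, AlgHom.commutes, Module.algebraMap_end_apply]
  · -- group elements: `ρ x v ↦ of x • _`, `τ̃ (of x) = of x`
    show ρ'.asModuleEquiv (F (ρ.asModuleEquiv.symm (ρ x v))) = ρ' x (ρ'.asModuleEquiv (F (ρ.asModuleEquiv.symm v)))
    rw [Representation.asModuleEquiv_symm_map_rho, LinearMap.map_smulₛₗ, mapRingHom_of,
      Representation.asModuleEquiv_map_smul, Representation.asAlgebraHom_of]

end GroupAlgebra

/-! ## §3 Representation form: the consumer's statement -/

section Representation

variable {k k' : Type*} [Field k] [Field k'] {τ : k →+* k'} [RingHomSurjective τ]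
variable {G H : Type*} [Group G] [Group H]
variable {W W' V V' : Type*} [AddCommGroup W] [Module k W] [AddCommGroup W'] [Module k' W']
  [AddCommGroup V] [Module k V] [AddCommGroup V'] [Module k' V']

/-- **THE SEMILINEAR UNIQUENESS CLAUSE (representation form).**  Let `τ : k →+* k'` be a surjective homomorphism of fields,
`φ : H →* G`, `π`, `π'` representations of `G` over `k`, `k'` on `W ≠ 0`, `W'`, and `f : W →ₛₗ[τ] W'` an INJECTIVE `τ`-semilinear
`G`-equivariant map (an embedding of the `τ`-twist `W^τ` into `W'`).  If `π|_H` is `ρ`-isotypic and `π'|_H` is `ρ'`-isotypic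
(`isotypicComponent … = ⊤` for the `k[H]`- resp. `k'[H]`-modules of `π ∘ φ`, `π' ∘ φ`; `ρ`, `ρ'` irreducible), then there is a
BIJECTIVE `τ`-semilinear `H`-equivariant map `V → V'` — the local type of `W'` is the `τ`-twist of the local type of `W`.  (`τ = id`,
`f` bijective: ✔ `Liu2021.nonempty_equiv_of_isotypicComponent_eq_top`.)
[cite: FlathCorvallis1979, Theorem 3 (uniqueness clause)] [cite: Bump1997, §3.4 Prop. 3.4.1 (last bullet)] -/
theorem exists_semilinear_equivariant_bijective_of_isotypicComponent_eq_top (φ : H →* G) {π : Representation k G W}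
    {π' : Representation k' G W'} [Nontrivial W] (f : W →ₛₗ[τ] W') (hf : Function.Injective f)
    (hfe : ∀ (g : G) (w : W), f (π g w) = π' g (f w)) {ρ : Representation k H V} {ρ' : Representation k' H V'}
    [ρ.IsIrreducible] [ρ'.IsIrreducible]
    (h : isotypicComponent k[H] (Representation.asModule (π.comp φ)) ρ.asModule = ⊤)
    (h' : isotypicComponent k'[H] (Representation.asModule (π'.comp φ)) ρ'.asModule = ⊤) :
    ∃ g : V →ₛₗ[τ] V', Function.Bijective g ∧ ∀ (x : H) (v : V), g (ρ x v) = ρ' x (g v) := by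
  haveI : RingHomSurjective (MonoidAlgebra.mapRingHom H τ) := ⟨mapRingHom_surjective τ H RingHomSurjective.is_surjective⟩
  haveI : Nontrivial (Representation.asModule (π.comp φ)) := ‹Nontrivial W›
  -- the restricted actions are intertwined by `f`
  have hfe' : ∀ (x : H) (w : W), f (π.comp φ x w) = π'.comp φ x (f w) := fun x w => hfe (φ x) w
  obtain ⟨F, hF⟩ := exists_mapRingHom_semilinear (π.comp φ) (π'.comp φ) f hfe'
  have hFinj : Function.Injective F := by
    intro x y hxy
    have := congrArg (Representation.asModuleEquiv (π'.comp φ)) hxy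
    rw [hF, hF] at this
    exact (Representation.asModuleEquiv (π.comp φ)).injective (hf this)
  -- module form
  obtain ⟨g₀, hg₀⟩ := exists_semilinear_bijective_of_isotypicComponent_eq_top h
    (IsIsotypicOfType.of_isotypicComponent_eq_top h') F hFinj
  -- back to `V → V'`
  obtain ⟨g, hg, hge⟩ := exists_semilinear_equivariant_of_mapRingHom_semilinear ρ ρ' g₀
  refine ⟨g, ?_, hge⟩
  have hcomp : (g : V → V') = ρ'.asModuleEquiv ∘ g₀ ∘ ρ.asModuleEquiv.symm := funext hg
  rw [hcomp]
  exact ρ'.asModuleEquiv.bijective.comp (hg₀.comp ρ.asModuleEquiv.symm.bijective)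

/-- The same with the roles of the hypotheses adapted to a BIJECTIVE `f` given as in row III-11 of the hodgecm-mathlib inventory
(`∃ f, Bijective f ∧ ∀ g w, f (π g w) = π' g (f w)`), for direct use by the consumer. [cite: FlathCorvallis1979, Theorem 3 (uniqueness clause)] -/
theorem exists_semilinear_equivariant_bijective_of_isotypicComponent_eq_top' (φ : H →* G) {π : Representation k G W}
    {π' : Representation k' G W'} [Nontrivial W]
    (hst : ∃ f : W →ₛₗ[τ] W', Function.Bijective f ∧ ∀ (g : G) (w : W), f (π g w) = π' g (f w))
    {ρ : Representation k H V} {ρ' : Representation k' H V'} [ρ.IsIrreducible] [ρ'.IsIrreducible]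
    (h : isotypicComponent k[H] (Representation.asModule (π.comp φ)) ρ.asModule = ⊤)
    (h' : isotypicComponent k'[H] (Representation.asModule (π'.comp φ)) ρ'.asModule = ⊤) :
    ∃ g : V →ₛₗ[τ] V', Function.Bijective g ∧ ∀ (x : H) (v : V), g (ρ x v) = ρ' x (g v) := by
  obtain ⟨f, hf, hfe⟩ := hst
  exact exists_semilinear_equivariant_bijective_of_isotypicComponent_eq_top φ f hf.1 hfe h h'

end Representation

end Literature.RepresentationTheory.Semisimple

end
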